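import Literature.Barriers.BirchSwinnertonDyer.RankNotSumOfLocalInvariantsF4Twists
import Literature.NumberTheory.EllipticCurves.KramerDescentLocalGeneratorsProofs
import HarnessLib

/-!
# Rank mod `4` over the fixed field `ℚ`: the eight twists of `480a1` form `4`-blocks at every place

Companion to `Literature/Barriers/BirchSwinnertonDyer/RankNotSumOfLocalInvariants.lean`, § Audit
2026-08-15, whose NARROWED record
`Literature.Barriers.BirchSwinnertonDyer.DokchitserDokchitser2011_rankMod_notSumOfLocalInvariantsNarrow`
has as conjunct (2) the fixed-base-field statement "`rk E(ℚ) mod 4` is not a sum over the places of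
`ℚ` of local invariants" (`¬ IsSumOfLocalInvariantsOver ℚ (fun W ↦ (W.mordellWeilRank : ZMod 4))`).
Its printed source is Lemma 5 of T. Dokchitser–V. Dokchitser, *A note on the Mordell–Weil rank
modulo `n`*, J. Number Theory 131 (2011) 1833–1839 (arXiv:0910.4588) — "Suppose an invariant
`Λ ∈ ℤ/2^kℤ` is a sum of local invariants. Let `F = K(√α_1, …, √α_m)` be a multi-quadratic
extension in which every prime of `K` splits into a multiple of `2^k` primes of `F`. Then for every
elliptic curve `E/K`, `Λ(E/K) + Σ_D Λ(E_D/K) = 0` […] *Proof.* In the local expression for the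
left-hand side of the formula each local term (`λ` of a given elliptic curve over a given local
field) occurs a multiple of `2^k` times" — applied with `K = ℚ`, `k = 2`,
`F = F₄ = ℚ(√-1, √41, √73)` and `E = 480a1 : y² = x(x+2)(x-3)` (proof of Thm. 2, loc. cit.).

The barrier file proves the abstract counting form of Lemma 5 over a fixed number field
(`Literature.Barriers.BirchSwinnertonDyer.not_isSumOfLocalInvariantsOver_of_blocks`: a finite
family of elliptic curves over `K` falling at every place into local isomorphism blocks of size
`≡ 0 (mod n)` kills every `ℤ/nℤ`-valued additive local formula on it). This file PROVES the local
input for the printed instance — what the barrier record lists as still named ("the local block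
structure of the eight twists (multiplicity of `E_D ⊗ ℚ_v` = `#{D' : D'/D ∈ ℚ_v^{×2}}` = number of
places of `F₄` above `v` ∈ `{4, 8}`; Silverman X.5.4)"):

* `DokchitserDokchitser2011.twist`: the family `E^{(d)}`, `d = (-1)^a 41^b 73^c`, indexed by
  `(a, b, c) : Fin 2 × Fin 2 × Fin 2` (`TwistIdx`), in the tree's model
  `WeierstrassCurve.quadraticTwist` (`E^{(d)} : y² = x³ - d x² - 6 d² x`);
* `DokchitserDokchitser2011.exists_variableChange_of_isSquare`: `E^{(d)} ≅ E^{(d')}` over any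
  field `L ⊇ ℚ` in which `d d'` is a square (the easy half of Silverman X.5.4: the twist depends on
  `d` modulo squares; tree `WeierstrassCurve.exists_variableChange_quadraticTwist_mul_sq`);
* `DokchitserDokchitser2011.padic_ker_isSquare`, `…real_ker_isSquare`: at every prime `p` and at
  `∞` a subgroup of index `≤ 2` of `V = ⟨-1, 41, 73⟩ ⊂ ℚ^×/ℚ^{×2}` consists of local squares —
  `⟨41, 73⟩` in `ℚ₂` (`41 ≡ 73 ≡ 1 mod 8`) and in `ℝ`, `⟨-1, 73⟩` in `ℚ₄₁`, `⟨-1, 41⟩` in `ℚ₇₃`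
  (explicit residues), and the kernel of the Legendre character `d ↦ (d/p)` at every other odd `p`
  (Hensel; tree `KramerLocal.padic_isSquare_intCast`, `…padicTwo_isSquare_intCast`);
* `DokchitserDokchitser2011.exists_blocks`: hence over any field `L ⊇ ℚ` with this property the
  eight twists fall into blocks (cosets of that subgroup) of size `4` or `8`, each block
  consisting of `L`-isomorphic curves — the hypothesis format of the barrier file's
  `not_isSumOfLocalInvariantsOver_of_blocks`.

The sequel `RankNotSumOfLocalInvariantsNarrowProofs.lean` transports this to the completions
`ℚ_v`, `ℚ_∞` (Lemma 5 for `(ℚ, F₄, 480a1)`, proved), feeds in the ranks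
(`Σ_d rk E^{(d)}(ℚ) = rk E(F₄) = 6 ≢ 0 mod 4`, from the tree's `F₄` descent leaf) and assembles
the NARROWED record from the same three named facts as the entry.

Design notes.
* All combinatorics of the index group `Fin 2 × Fin 2 × Fin 2` (fibre sizes of the block maps,
  multiplicativity of `d` up to squares, kernels of characters) is settled by `decide`.
* `exists_blocks` is stated for an arbitrary `ℚ`-algebra `L` that is a field, so that it applies to
  the completions with whatever `Algebra ℚ _` instance the barrier lemma carries (all such instances
  are equal, `algebra_rat_subsingleton`; use `convert` at the call site).

## References

* T. Dokchitser, V. Dokchitser, *A note on the Mordell–Weil rank modulo `n`*, J. Number Theory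
  131 (2011) 1833–1839, arXiv:0910.4588: §1, Lemma 5 with proof, proof of Thm. 2 (`E = 480a1`,
  `F₄ = ℚ(√-1, √41, √73)`), p. 3 of the held arXiv copy. [DokchitserDokchitser2011RankModN]
* J. H. Silverman, *The Arithmetic of Elliptic Curves*, 2nd ed., GTM 106 (2009): X.5 Prop. 5.4 and
  Cor. 5.4.1 (twists `E_D`, `D mod (K^*)^2`), p. 295 of the held copy. [SilvermanAEC2009]
* J.-P. Serre, *A Course in Arithmetic* (1973), Ch. II §3.3 Thms. 3–4 (squares in `ℚ_p`), through
  the tree lemmas of `KramerDescentLocalGeneratorsProofs.lean`. [Serre1973]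
-/

noncomputable section

attribute [-instance] instDecidableEqQuadraticAlgebra

open scoped Classical

namespace Literature.Barriers.BirchSwinnertonDyer

namespace DokchitserDokchitser2011

open WeierstrassCurve

/-! ### The index group `V = ⟨-1, 41, 73⟩ ≅ (ℤ/2)³` and the twisting parameters -/

/-- Index set of the eight quadratic twists: exponent vectors `(a, b, c)` of `-1, 41, 73`, an
`𝔽₂`-vector space of dimension `3` (the quadratic subfields of `F₄ = ℚ(√-1, √41, √73)` together
with the trivial class). [cite: DokchitserDokchitser2011RankModN, Lemma 5 and proof of Thm. 2] -/
abbrev TwistIdx : Type := Fin 2 × Fin 2 × Fin 2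

/-- The twisting parameter `d(a, b, c) = (-1)^a · 41^b · 73^c ∈ {±1, ±41, ±73, ±2993}`.
[cite: DokchitserDokchitser2011RankModN, proof of Thm. 2] -/
def twistParam : TwistIdx → ℤ
  | (a, b, c) => (if a = 1 then -1 else 1) * (if b = 1 then 41 else 1) * (if c = 1 then 73 else 1)

/-- The square root of `d(D) d(D') / d(D + D')`: the product of the bases occurring in both.
[folklore] -/
def sqFactor : TwistIdx → TwistIdx → ℤ
  | (a, b, c), (a', b', c') =>
    (if a = 1 ∧ a' = 1 then -1 else 1) * (if b = 1 ∧ b' = 1 then 41 else 1) *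
      (if c = 1 ∧ c' = 1 then 73 else 1)

/-- `d` is a homomorphism to `ℚ^×/ℚ^{×2}`: `d(D) d(D') = d(D + D') · (square)`. [folklore] -/
theorem twistParam_mul_twistParam (D D' : TwistIdx) :
    twistParam D * twistParam D' = twistParam (D + D') * sqFactor D D' ^ 2 := by
  revert D D'
  decide

/-- `d(D) ≠ 0`. [folklore] -/
theorem twistParam_ne_zero (D : TwistIdx) : twistParam D ≠ 0 := by
  revert D
  decide

/-- `d(a, b, c) = (-1)^a 41^b 73^c` as a product of powers. [folklore] -/
theorem twistParam_eq_pow (D : TwistIdx) :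
    twistParam D = (-1) ^ D.1.val * 41 ^ D.2.1.val * 73 ^ D.2.2.val := by
  revert D
  decide

/-- The `𝔽₂`-valued character `χ_c(D) = c · D` of the index group attached to `c : TwistIdx`
(every character of `(ℤ/2)³` is of this form). [folklore] -/
def chi (c D : TwistIdx) : Fin 2 := c.1 * D.1 + c.2.1 * D.2.1 + c.2.2 * D.2.2

/-- A fixed element outside `ker χ_c` (when `c ≠ 0`). [folklore] -/
def blockRep (c : TwistIdx) : TwistIdx :=
  if c.1 = 1 then (1, 0, 0) else if c.2.1 = 1 then (0, 1, 0) else (0, 0, 1)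

/-- The block map of `χ_c`: collapses `ker χ_c` to `0` and its complement to `blockRep c`, so
that its non-empty fibres are the cosets of `ker χ_c` (of size `4`, or `8` when `c = 0`).
[cite: DokchitserDokchitser2011RankModN, Lemma 5 (proof)] -/
def blockMap (c D : TwistIdx) : TwistIdx := if chi c D = 0 then 0 else blockRep c

/-- "Each local term occurs a multiple of `2^k` times", `k = 2`: every fibre of a block map has
cardinality divisible by `4`. [cite: DokchitserDokchitser2011RankModN, Lemma 5 (proof)] -/
theorem four_dvd_card_filter_blockMap (c j : TwistIdx) :
    4 ∣ (Finset.univ.filter fun D ↦ blockMap c D = j).card := by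
  revert c j
  decide

/-- `D` and its block representative differ by an element of `ker χ_c`. [folklore] -/
theorem chi_add_blockMap (c D : TwistIdx) : chi c (D + blockMap c D) = 0 := by
  revert c D
  decide

/-! ### The eight twists of `480a1` and their local isomorphisms -/

/-- **The eight quadratic twists `E^{(d)}` of `E = 480a1`**, `d = d(D) ∈ {±1, ±41, ±73, ±2993}`
— the curves `E_D` of Lemma 5 of Dokchitser–Dokchitser (2011) for `K = ℚ`,
`F = F₄ = ℚ(√-1, √41, √73)` (`E^{(1)} ≅ E`), in the tree's model `WeierstrassCurve.quadraticTwist`: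
`E^{(d)} : y² = x³ - d x² - 6 d² x`. [cite: DokchitserDokchitser2011RankModN, Lemma 5 and proof of Thm. 2] -/
def twist (D : TwistIdx) : WeierstrassCurve ℚ :=
  curve480a1.quadraticTwist (twistParam D : ℚ)

/-- Each twist is an elliptic curve (`Δ(E^{(d)}) = d⁶ Δ(E) ≠ 0`). [folklore] -/
instance twist.instIsElliptic (D : TwistIdx) : (twist D).IsElliptic :=
  curve480a1.isElliptic_quadraticTwist (by exact_mod_cast twistParam_ne_zero D)

section Blocks

variable {L : Type*} [Field L]

/-- Base change of a twist is the twist of the base change (twisting is given by universal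
formulas; tree `WeierstrassCurve.map_quadraticTwist`). [folklore] -/
theorem twist_baseChange [Algebra ℚ L] (D : TwistIdx) :
    (twist D).baseChange L = (curve480a1.baseChange L).quadraticTwist (twistParam D : L) := by
  rw [twist, baseChange, map_quadraticTwist, map_intCast]
  rfl

/-- A non-zero integer is non-zero in a field containing `ℚ`. [folklore] -/
theorem intCast_ne_zero_of_ne_zero [Algebra ℚ L] {n : ℤ} (hn : n ≠ 0) : (n : L) ≠ 0 := by
  rw [← map_intCast (algebraMap ℚ L), map_ne_zero]
  exact_mod_cast hn

/-- **`E^{(d)} ≅ E^{(d')}` over `L` when `d d' ∈ L^{×2}`** (Silverman, *AEC* X.5.4: the twist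
`E_D` depends only on `D mod (L^*)²`; here the easy direction, by the rescaling
`(x, y) ↦ (e²x, e³y)`, `e = √(d d')/d`, of the tree's
`WeierstrassCurve.exists_variableChange_quadraticTwist_mul_sq`).
[cite: SilvermanAEC2009, X.5 Prop. 5.4] -/
theorem exists_variableChange_of_isSquare [Algebra ℚ L] (D D' : TwistIdx)
    (h : IsSquare ((twistParam D * twistParam D' : ℤ) : L)) :
    ∃ C : VariableChange L, C • (twist D).baseChange L = (twist D').baseChange L := by
  obtain ⟨s, hs⟩ := h
  have hd : (twistParam D : L) ≠ 0 := intCast_ne_zero_of_ne_zero (twistParam_ne_zero D)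
  have hd' : (twistParam D' : L) ≠ 0 := intCast_ne_zero_of_ne_zero (twistParam_ne_zero D')
  have hs0 : s ≠ 0 := by
    rintro rfl
    rw [mul_zero, Int.cast_mul] at hs
    exact mul_ne_zero hd hd' hs
  obtain ⟨C, hC⟩ := (curve480a1.baseChange L).exists_variableChange_quadraticTwist_mul_sq
    (twistParam D : L) (s / twistParam D) (div_ne_zero hs0 hd)
  refine ⟨C, ?_⟩
  rw [twist_baseChange, twist_baseChange, hC]
  congr 1
  rw [Int.cast_mul] at hs
  field_simp
  linear_combination (-1 : L) * hs

/-- If `d` is a square in `L` on the kernel of `χ_c`, then `d(D) · d(block representative of D)`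
is a square in `L` (the two differ by a kernel element, up to the square `sqFactor²`).
[folklore] -/
theorem isSquare_twistParam_mul_of_ker (c : TwistIdx)
    (hker : ∀ D, chi c D = 0 → IsSquare ((twistParam D : ℤ) : L)) (D : TwistIdx) :
    IsSquare ((twistParam D * twistParam (blockMap c D) : ℤ) : L) := by
  obtain ⟨s, hs⟩ := hker _ (chi_add_blockMap c D)
  refine ⟨s * sqFactor D (blockMap c D), ?_⟩
  rw [twistParam_mul_twistParam, Int.cast_mul, hs]
  push_cast
  ring

/-- **Local `4`-blocks.** Over a field `L ⊇ ℚ` in which `d(D)` is a square for every `D` in the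
kernel of some character `χ_c`, the eight twists fall into blocks of `L`-isomorphic curves of size
divisible by `4` (hence by any `n ∣ 4`): the block map `blockMap c` and the isomorphisms of
`exists_variableChange_of_isSquare`. This is the local input of Lemma 5 of Dokchitser–Dokchitser
(2011) ("each local term occurs a multiple of `2^k` times") for `(ℚ, F₄, 480a1)`, in the format of
`Literature.Barriers.BirchSwinnertonDyer.not_isSumOfLocalInvariantsOver_of_blocks`.
[cite: DokchitserDokchitser2011RankModN, Lemma 5 (proof)] -/
theorem exists_blocks [Algebra ℚ L] {n : ℕ} (hn : n ∣ 4)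
    (h : ∃ c : TwistIdx, ∀ D, chi c D = 0 → IsSquare ((twistParam D : ℤ) : L)) :
    ∃ m : TwistIdx → TwistIdx,
      (∀ D, ∃ C : VariableChange L, C • (twist D).baseChange L = (twist (m D)).baseChange L) ∧
      ∀ j, n ∣ (Finset.univ.filter fun D ↦ m D = j).card := by
  obtain ⟨c, hc⟩ := h
  exact ⟨blockMap c, fun D ↦ exists_variableChange_of_isSquare D _
    (isSquare_twistParam_mul_of_ker c hc D), fun j ↦ hn.trans (four_dvd_card_filter_blockMap c j)⟩

/-- The kernel of `χ_{(1,0,0)}` is `⟨41, 73⟩ = {1, 41, 73, 2993}`: if `41` and `73` are squares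
in `L`, so is `d(D)` for every `D` in it. [folklore] -/
theorem ker_isSquare_of_isSquare_41_73 (h41 : IsSquare ((41 : ℤ) : L))
    (h73 : IsSquare ((73 : ℤ) : L)) :
    ∀ D, chi (1, 0, 0) D = 0 → IsSquare ((twistParam D : ℤ) : L) := by
  obtain ⟨s, hs⟩ := h41
  obtain ⟨t, ht⟩ := h73
  intro D hD
  fin_cases D <;> simp [chi] at hD <;> simp only [twistParam, Fin.isValue]
  · exact ⟨1, by norm_num⟩
  · exact ⟨t, by simpa using ht⟩
  · exact ⟨s, by simpa using hs⟩
  · exact ⟨s * t, by push_cast at hs ht ⊢; linear_combination t * t * hs + 41 * ht⟩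

end Blocks

/-! ### Local squares: `ℚ_p` for every prime `p`, and `ℝ` -/

section Padic

open Literature.NumberTheory.EllipticCurves.KramerLocal

/-- The Legendre symbol is multiplicative in powers. [folklore] -/
theorem legendreSym_pow (p : ℕ) [Fact p.Prime] (a : ℤ) (n : ℕ) :
    legendreSym p (a ^ n) = legendreSym p a ^ n := by
  induction n with
  | zero => simp [legendreSym.at_one]
  | succ n ih => rw [pow_succ, legendreSym.mul, ih, pow_succ]

/-- The bit of a sign: `1 ↦ 0`, `-1 ↦ 1`. [folklore] -/
def signBit (s : ℤ) : Fin 2 := if s = -1 then 1 else 0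

/-- A prime `q ≠ p` is non-zero in `ZMod p`. [folklore] -/
theorem intCast_zmod_ne_zero_of_prime {p q : ℕ} [hp : Fact p.Prime] (hq : q.Prime) (hpq : p ≠ q) :
    ((q : ℤ) : ZMod p) ≠ 0 := by
  rw [Ne, ZMod.intCast_zmod_eq_zero_iff_dvd, Int.natCast_dvd_natCast,
    Nat.prime_dvd_prime_iff_eq hp.out hq]
  exact hpq

/-- **Odd `p ∉ {41, 73}`**: the kernel of the Legendre character
`D ↦ (d(D)/p) = (-1/p)^a (41/p)^b (73/p)^c` consists of `D` with `d(D)` a non-zero square modulo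
`p`, hence a square in `ℚ_p` (Hensel, Serre II.3.3 Thm. 3; tree `KramerLocal.padic_isSquare_intCast`).
This character is `χ_c` for `c` = the vector of sign bits of `(-1/p), (41/p), (73/p)`.
[cite: Serre1973, Ch. II §3.3 Thm 3] -/
theorem padic_ker_isSquare_of_ne (p : ℕ) [hp : Fact p.Prime] (hp2 : p ≠ 2) (hp41 : p ≠ 41)
    (hp73 : p ≠ 73) :
    ∃ c : TwistIdx, ∀ D, chi c D = 0 → IsSquare ((twistParam D : ℤ) : ℚ_[p]) := by
  have hm1 : ((-1 : ℤ) : ZMod p) ≠ 0 := by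
    rw [Int.cast_neg, Int.cast_one]
    exact neg_ne_zero.mpr one_ne_zero
  have h41 : ((41 : ℤ) : ZMod p) ≠ 0 := intCast_zmod_ne_zero_of_prime (by norm_num) hp41
  have h73 : ((73 : ℤ) : ZMod p) ≠ 0 := intCast_zmod_ne_zero_of_prime (by norm_num) hp73
  refine ⟨(signBit (legendreSym p (-1)), signBit (legendreSym p 41), signBit (legendreSym p 73)),
    fun D hD ↦ ?_⟩
  have hD0 : ((twistParam D : ℤ) : ZMod p) ≠ 0 := by
    rw [twistParam_eq_pow]
    push_cast
    refine mul_ne_zero (mul_ne_zero (pow_ne_zero _ ?_) (pow_ne_zero _ ?_)) (pow_ne_zero _ ?_)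
    · exact neg_ne_zero.mpr one_ne_zero
    · exact_mod_cast h41
    · exact_mod_cast h73
  apply padic_isSquare_intCast hp2 hD0
  rw [← legendreSym.eq_one_iff p hD0, twistParam_eq_pow, legendreSym.mul, legendreSym.mul,
    legendreSym_pow, legendreSym_pow, legendreSym_pow]
  clear hD0
  rcases legendreSym.eq_one_or_neg_one p hm1 with h1 | h1 <;>
  rcases legendreSym.eq_one_or_neg_one p h41 with h2 | h2 <;>
  rcases legendreSym.eq_one_or_neg_one p h73 with h3 | h3 <;>
  · rw [h1, h2, h3] at hD ⊢
    revert D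
    decide

/-- Residues modulo `41`: `-1 ≡ 9²`, `73 ≡ 14²`, `-73 ≡ 3²` are non-zero squares. [folklore] -/
theorem zmod41_squares :
    (((-1 : ℤ) : ZMod 41) ≠ 0 ∧ IsSquare ((-1 : ℤ) : ZMod 41)) ∧
      (((73 : ℤ) : ZMod 41) ≠ 0 ∧ IsSquare ((73 : ℤ) : ZMod 41)) ∧
      (((-73 : ℤ) : ZMod 41) ≠ 0 ∧ IsSquare ((-73 : ℤ) : ZMod 41)) := by
  refine ⟨⟨by decide, ⟨9, by decide⟩⟩, ⟨by decide, ⟨14, by decide⟩⟩, ⟨by decide, ⟨3, by decide⟩⟩⟩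

/-- Residues modulo `73`: `-1 ≡ 27²`, `41 ≡ 25²`, `-41 ≡ 18²` are non-zero squares. [folklore] -/
theorem zmod73_squares :
    (((-1 : ℤ) : ZMod 73) ≠ 0 ∧ IsSquare ((-1 : ℤ) : ZMod 73)) ∧
      (((41 : ℤ) : ZMod 73) ≠ 0 ∧ IsSquare ((41 : ℤ) : ZMod 73)) ∧
      (((-41 : ℤ) : ZMod 73) ≠ 0 ∧ IsSquare ((-41 : ℤ) : ZMod 73)) := by
  refine ⟨⟨by decide, ⟨27, by decide⟩⟩, ⟨by decide, ⟨25, by decide⟩⟩, ⟨by decide, ⟨18, by decide⟩⟩⟩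

/-- **`p = 41`**: the kernel `{1, -1, 73, -73}` of `χ_{(0,1,0)}` consists of squares in `ℚ₄₁`
(`41 ≡ 1 mod 4`, `(73/41) = 1`; Hensel). [cite: Serre1973, Ch. II §3.3 Thm 3] -/
theorem padic_ker_isSquare_41 [Fact (Nat.Prime 41)] :
    ∃ c : TwistIdx, ∀ D, chi c D = 0 → IsSquare ((twistParam D : ℤ) : ℚ_[41]) := by
  obtain ⟨⟨h1, h1'⟩, ⟨h2, h2'⟩, ⟨h3, h3'⟩⟩ := zmod41_squares
  refine ⟨(0, 1, 0), fun D hD ↦ ?_⟩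
  have hsq : ∀ n : ℤ, n ∈ ({1, -1, 73, -73} : Finset ℤ) → IsSquare ((n : ℤ) : ℚ_[41]) := by
    intro n hn
    simp only [Finset.mem_insert, Finset.mem_singleton] at hn
    rcases hn with rfl | rfl | rfl | rfl
    · exact ⟨1, by norm_num⟩
    · exact padic_isSquare_intCast (by norm_num) h1 h1'
    · exact padic_isSquare_intCast (by norm_num) h2 h2'
    · exact padic_isSquare_intCast (by norm_num) h3 h3'
  apply hsq
  revert D
  decide

/-- **`p = 73`**: the kernel `{1, -1, 41, -41}` of `χ_{(0,0,1)}` consists of squares in `ℚ₇₃`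
(`73 ≡ 1 mod 4`, `(41/73) = 1`; Hensel). [cite: Serre1973, Ch. II §3.3 Thm 3] -/
theorem padic_ker_isSquare_73 [Fact (Nat.Prime 73)] :
    ∃ c : TwistIdx, ∀ D, chi c D = 0 → IsSquare ((twistParam D : ℤ) : ℚ_[73]) := by
  obtain ⟨⟨h1, h1'⟩, ⟨h2, h2'⟩, ⟨h3, h3'⟩⟩ := zmod73_squares
  refine ⟨(0, 0, 1), fun D hD ↦ ?_⟩
  have hsq : ∀ n : ℤ, n ∈ ({1, -1, 41, -41} : Finset ℤ) → IsSquare ((n : ℤ) : ℚ_[73]) := by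
    intro n hn
    simp only [Finset.mem_insert, Finset.mem_singleton] at hn
    rcases hn with rfl | rfl | rfl | rfl
    · exact ⟨1, by norm_num⟩
    · exact padic_isSquare_intCast (by norm_num) h1 h1'
    · exact padic_isSquare_intCast (by norm_num) h2 h2'
    · exact padic_isSquare_intCast (by norm_num) h3 h3'
  apply hsq
  revert D
  decide

/-- **`p = 2`**: `41 ≡ 73 ≡ 1 (mod 8)` are squares in `ℚ₂` (Serre II.3.3 Thm. 4; tree
`KramerLocal.padicTwo_isSquare_intCast`), so the kernel `⟨41, 73⟩` of `χ_{(1,0,0)}` consists of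
squares. [cite: Serre1973, Ch. II §3.3 Thm 4] -/
theorem padic_ker_isSquare_two :
    ∃ c : TwistIdx, ∀ D, chi c D = 0 → IsSquare ((twistParam D : ℤ) : ℚ_[2]) :=
  ⟨(1, 0, 0), ker_isSquare_of_isSquare_41_73 (padicTwo_isSquare_intCast ⟨5, by norm_num⟩)
    (padicTwo_isSquare_intCast ⟨9, by norm_num⟩)⟩

/-- **Every prime `p`**: some character of the index group has kernel consisting of `D` with
`d(D) ∈ ℚ_p^{×2}` — i.e. the image of `⟨-1, 41, 73⟩` in `ℚ_p^×/ℚ_p^{×2}` has order `≤ 2`, the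
local content of "every prime of `ℚ` splits into a multiple of `4` primes of `F₄`"
(cases `p = 2`, `41`, `73`, other). [cite: DokchitserDokchitser2011RankModN, proof of Thm. 2] -/
theorem padic_ker_isSquare (p : ℕ) [Fact p.Prime] :
    ∃ c : TwistIdx, ∀ D, chi c D = 0 → IsSquare ((twistParam D : ℤ) : ℚ_[p]) := by
  by_cases hp2 : p = 2
  · subst hp2
    exact padic_ker_isSquare_two
  by_cases hp41 : p = 41
  · subst hp41
    exact padic_ker_isSquare_41
  by_cases hp73 : p = 73
  · subst hp73
    exact padic_ker_isSquare_73
  exact padic_ker_isSquare_of_ne p hp2 hp41 hp73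

/-- **The real place**: `41, 73 > 0` are squares in `ℝ`, so the kernel `⟨41, 73⟩` of
`χ_{(1,0,0)}` (the positive `d`) consists of squares. [folklore] -/
theorem real_ker_isSquare :
    ∃ c : TwistIdx, ∀ D, chi c D = 0 → IsSquare ((twistParam D : ℤ) : ℝ) :=
  ⟨(1, 0, 0), ker_isSquare_of_isSquare_41_73 (real_isSquare_intCast (by norm_num))
    (real_isSquare_intCast (by norm_num))⟩

end Padic

end DokchitserDokchitser2011

end Literature.Barriers.BirchSwinnertonDyer

end
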